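import Summits.Ventures.HSemireg.MethodInstanceG6ThetaSecantReachYesCertificates
import HarnessLib

/-!
# Venture HSemireg — the NO-type of the g = 6 theta-secant reach table is an invariant too (Legendre's theorem at `d ≡ 3 (mod 4)` completed),
# and the fundamental solution of `x² − p·y² = 1` modulo a prime `p ≡ 3 (mod 4)`

HONEST FRAMING. Lean index of the computation cell `pub-hsemireg` (seat p8, «Sunday typer § g = 6»; sequel of
`MethodInstanceG6ThetaSecantReachYesCertificates.lean`). ELEMENTARY NUMBER THEORY only (the classical 2-descent on `x² − d·y² = 1`); no variety, sheaf
or `Ext` group is constructed and no Weil-class statement is made in this file. Nothing here says HC, HC_CM or HC_AV is proved; the reach concerns SPLIT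
sixfold components (method instances; the verdict's deciding rows stay «NO-in-families-tried», candidates 0).

WHAT IT ADDS. The reach of `ℚ(√-d)` (`d` odd, non-square) by a theta-secant parameter is decided by exactly one of two finite certificates —
NO ⟺ some `b·v² − a·u² = 1` with `a·b = d`, `1 < b` (`MethodInstanceG6ThetaSecantReachCertificates.lean`), YES ⟺ some `b·v² − a·u² = 2` with `a·b = d`
(predecessor) —, and the YES-type `(a, b)` is unique (predecessor §2). Here the NO-type is unique as well:
* §1 HALF-DESCENT WITH THE LINK (`pell_plusOneSplit_of_odd`): for odd `d > 0`, an ODD positive `x` with `x² − d·y² = 1` splits as `x = 2·a·u² + 1`,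
  `b·v² − a·u² = 1`, `a·b = d` (no minimality used, `b = 1` allowed) — the descent of `pell_certificate_of_odd_fundamental_x`, keeping the identity
  `x = 2·a·u² + 1` that its statement discards.
* §2 THE NO-TYPE IS AN INVARIANT (`thetaSecant_plusOneCertificate_unique`): for odd non-square `d`, two NO-certificates (`1 < b`, `1 < b'`) have
  `(a, b) = (a', b')`. Route: a certificate's solution `(2b·v² − 1, 2u·v)` is `a₁ⁿ`; with the fundamental split `x₁ = 2·a₀·u₀² + 1` and `x_n ≡ x₁ⁿ (mod d)`
  (predecessor `pell_dvd_x_zpow_sub`; `pell_noType_dvd_zpow`): `n` even would give `d ∣ x_n − 1 = 2·a·u²`, so `b ∣ a·u²` and `b = 1`; `n` odd gives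
  `a₀ ∣ a·u²`, `b₀ ∣ a·u² + 1 = b·v²`, and divisors of the coprime pair `a·u²`, `a·u² + 1` with the right products coincide (`plusOneType_eq_of_dvd`).
  TOGETHER (`thetaSecant_legendre_uniqueness`; Legendre's theorem at `d ≡ 3 (mod 4)` in the cell's currency): for odd non-square `d`, among the ordered
  factorisations `d = a·b` EXACTLY ONE equation of the list «`b·v² − a·u² = 1` (`1 < b`)», «`b·v² − a·u² = 2`» is solvable — the reach table's NO-type or
  YES-type of `d`.
* §3 THE FUNDAMENTAL SOLUTION MODULO `p` (`pell_fundamental_x_modEq_of_prime`): for a prime `p ≡ 3 (mod 4)`, `x₁ ≡ -1 (mod p)` if `p ≡ 3 (mod 8)` and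
  `x₁ ≡ 1 (mod p)` if `p ≡ 7 (mod 8)` (`x₁` is even, its YES-certificate reads `x₁ = a·u² + 1 = b·v² − 1`, and the type is `(1, p)` resp. `(p, 1)` by the
  predecessor's `pell_plusTwo_prime_type`) — classical, here with no datum.
Source of the sentence: `step0/THETA-SECANT-p1.md` v2.6 §1 «COVERAGE (Pell)»; census `target-g6/CENSUS.md` row D-2 REACH cell. 0 `def`, 0 `sorry`,
0 named fact.
-/

noncomputable section

open CategoryTheory AlgebraicGeometry
open Literature.AlgebraicGeometry.Motives Literature.AlgebraicGeometry.HodgeTheory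
open Literature.AlgebraicGeometry.ModuliOfAbelianVarieties Literature.AlgebraicGeometry.Deligne1982
open Literature.AlgebraicGeometry.KTheory
open Literature.AlgebraicTopology.SingularHomology

namespace Summit.Ventures.HSemireg

section PellNoTypes

open Pell

/-! ## §1 The half-descent of an odd `x`, keeping the link `x = 2·a·u² + 1` -/

/-- **HALF-DESCENT WITH THE LINK.** For odd `d > 0`: an ODD `x > 0` with `x² − d·y² = 1` yields `a·b = d`, `0 < a`, `0 < b`, `x = 2·a·u² + 1` and
`b·v² − a·u² = 1` (`x = 2t + 1`, `y = 2w`, `t·(t + 1) = d·w²`; `a = gcd(t, d)`, `b = d/a ∣ t + 1`; the cofactors are coprime with square product). No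
minimality is used, so `b = 1` is possible here (excluded for the FUNDAMENTAL `x` by `pell_certificate_of_odd_fundamental_x`). [bookkeeping] -/
theorem pell_plusOneSplit_of_odd {d : ℤ} (hd : 0 < d) (hdo : Odd d) {x y : ℤ} (hx : Odd x) (hx0 : 0 < x) (hxy : x ^ 2 - d * y ^ 2 = 1) :
    ∃ a b u v : ℤ, a * b = d ∧ 0 < a ∧ 0 < b ∧ x = 2 * a * u ^ 2 + 1 ∧ b * v ^ 2 - a * u ^ 2 = 1 := by
  have hd0 : d ≠ 0 := hd.ne'
  obtain ⟨t, ht⟩ := hx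
  have ht0 : 0 ≤ t := by omega
  have hyeven : Even y := by
    by_contra hy
    have hodd : Odd (d * y ^ 2) := hdo.mul (Int.not_even_iff_odd.1 hy).pow
    exact (Int.not_even_iff_odd.2 hodd) ⟨2 * (t * (t + 1)), by linear_combination (-1 : ℤ) * hxy + (x + 2 * t + 1) * ht⟩
  obtain ⟨w, hw⟩ := hyeven
  have key : t * (t + 1) = d * w ^ 2 := by
    refine mul_left_cancel₀ (by norm_num : (4 : ℤ) ≠ 0) ?_
    linear_combination hxy - (x + 2 * t + 1) * ht + d * (y + 2 * w) * hw
  obtain ⟨g, X', d', hg0, hcop, hX', hd'⟩ := Int.exists_gcd_one' (Int.gcd_pos_of_ne_zero_right t hd0)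
  have hg0' : (0 : ℤ) < g := by exact_mod_cast hg0
  have hcop' : IsCoprime X' d' := Int.isCoprime_iff_gcd_eq_one.2 hcop
  have hd'0 : 0 < d' := by
    have : 0 < d' * (g : ℤ) := by rw [← hd']; exact hd
    by_contra hle; push Not at hle; nlinarith
  have hX'0 : 0 ≤ X' := by
    have : 0 ≤ X' * (g : ℤ) := by rw [← hX']; exact ht0
    by_contra hle; push Not at hle; nlinarith
  have key' : X' * (t + 1) = d' * w ^ 2 := by
    refine mul_left_cancel₀ hg0'.ne' ?_
    calc (g : ℤ) * (X' * (t + 1)) = t * (t + 1) := by rw [hX']; ring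
      _ = g * (d' * w ^ 2) := by rw [key, hd']; ring
  obtain ⟨s, hs⟩ : d' ∣ t + 1 := hcop'.symm.dvd_of_dvd_mul_left ⟨w ^ 2, key'⟩
  have hprod : X' * s = w ^ 2 := by
    have e : d' * (X' * s) = d' * w ^ 2 := by rw [← key', hs]; ring
    exact mul_left_cancel₀ hd'0.ne' e
  have hcopXs : IsCoprime X' s := by
    have h0 : IsCoprime (X' * (g : ℤ)) (d' * s) := by rw [← hX', ← hs]; exact ⟨-1, 1, by ring⟩
    exact h0.of_mul_left_left.of_mul_right_right
  obtain ⟨u, hu⟩ := Int.sq_of_isCoprime hcopXs hprod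
  obtain ⟨v, hv⟩ := Int.sq_of_isCoprime hcopXs.symm (by rw [mul_comm]; exact hprod)
  have hXu : X' = u ^ 2 := hu.elim id fun hu ↦ by nlinarith [sq_nonneg u]
  have hs0 : 0 < s := by
    have : 0 < d' * s := by rw [← hs]; omega
    by_contra hle; push Not at hle; nlinarith
  have hsv : s = v ^ 2 := hv.elim id fun hv ↦ by nlinarith [sq_nonneg v]
  refine ⟨g, d', u, v, by rw [hd', mul_comm], hg0', hd'0, ?_, ?_⟩
  · rw [ht, hX', hXu]; ring
  · rw [← hsv, ← hXu]; linear_combination hX' - hs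

/-! ## §2 The NO-type `(a, b)` is an invariant of `d` -/

/-- **Divisors of the coprime pair `N = a·u²`, `N + 1 = b·v²` with the right products coincide**: `a₀·b₀ = a·b`, `a₀ ∣ N`, `b₀ ∣ N + 1` ⟹ `a = a₀`.
[bookkeeping] -/
theorem plusOneType_eq_of_dvd {a b u v a₀ b₀ : ℕ} (hcert : b * v ^ 2 = a * u ^ 2 + 1) (h₀ : a₀ * b₀ = a * b)
    (ha₀ : a₀ ∣ a * u ^ 2) (hb₀ : b₀ ∣ a * u ^ 2 + 1) : a = a₀ := by
  have hcop : Nat.Coprime (a * u ^ 2) (a * u ^ 2 + 1) := Nat.coprime_self_add_right.2 (Nat.coprime_one_right _)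
  have h1 : Nat.Coprime a b₀ := (hcop.coprime_dvd_left (Dvd.intro _ rfl)).coprime_dvd_right hb₀
  have h2 : Nat.Coprime a₀ b := (hcop.coprime_dvd_left ha₀).coprime_dvd_right ⟨v ^ 2, hcert.symm⟩
  exact Nat.dvd_antisymm (h1.dvd_of_dvd_mul_right (by rw [h₀]; exact Dvd.intro b rfl))
    (h2.dvd_of_dvd_mul_right (by rw [← h₀]; exact Dvd.intro b₀ rfl))

/-- **Reference divisibility along the powers (odd world).** If `x₁ = 2·a₀·u₀² + 1` with `b₀·v₀² − a₀·u₀² = 1`, `a₀·b₀ = d`, then for every `n : ℤ`: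
`a₀ ∣ x_n − 1`; `b₀ ∣ x_n + 1` if `n` is odd, `b₀ ∣ x_n − 1` if `n` is even (`x_n ≡ x₁^|n| (mod d)`, `x₁ ≡ 1 (mod a₀)`, `x₁ ≡ -1 (mod b₀)`). [bookkeeping] -/
theorem pell_noType_dvd_zpow {d : ℤ} (a₁ : Solution₁ d) {a₀ b₀ u₀ v₀ : ℤ} (hab₀ : a₀ * b₀ = d) (hx₁ : a₁.x = 2 * a₀ * u₀ ^ 2 + 1)
    (hc₀ : b₀ * v₀ ^ 2 - a₀ * u₀ ^ 2 = 1) (n : ℤ) :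
    a₀ ∣ (a₁ ^ n).x - 1 ∧ (Odd n → b₀ ∣ (a₁ ^ n).x + 1) ∧ (Even n → b₀ ∣ (a₁ ^ n).x - 1) := by
  have hdvd : d ∣ (a₁ ^ n).x - a₁.x ^ n.natAbs := pell_dvd_x_zpow_sub a₁ n
  have ha₀d : a₀ ∣ d := ⟨b₀, hab₀.symm⟩
  have hb₀d : b₀ ∣ d := ⟨a₀, by rw [← hab₀, mul_comm]⟩
  have h1 : a₁.x ≡ 1 [ZMOD a₀] := Int.modEq_iff_dvd.2 ⟨-(2 * u₀ ^ 2), by rw [hx₁]; ring⟩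
  have h2 : a₁.x ≡ -1 [ZMOD b₀] := Int.modEq_iff_dvd.2 ⟨-(2 * v₀ ^ 2), by linear_combination (-1 : ℤ) * hx₁ + 2 * hc₀⟩
  have h1n : a₁.x ^ n.natAbs ≡ 1 [ZMOD a₀] := by simpa using h1.pow n.natAbs
  refine ⟨?_, fun hn ↦ ?_, fun hn ↦ ?_⟩
  · have e := dvd_add (dvd_trans ha₀d hdvd) (Int.ModEq.dvd h1n.symm)
    rwa [sub_add_sub_cancel] at e
  · have h2n : a₁.x ^ n.natAbs ≡ -1 [ZMOD b₀] := by simpa [(Int.natAbs_odd.2 hn).neg_one_pow] using h2.pow n.natAbs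
    have e := dvd_add (dvd_trans hb₀d hdvd) (Int.ModEq.dvd h2n.symm)
    rwa [sub_add_sub_cancel, sub_neg_eq_add] at e
  · have h2n : a₁.x ^ n.natAbs ≡ 1 [ZMOD b₀] := by simpa [(Int.natAbs_even.2 hn).neg_one_pow] using h2.pow n.natAbs
    have e := dvd_add (dvd_trans hb₀d hdvd) (Int.ModEq.dvd h2n.symm)
    rwa [sub_add_sub_cancel] at e

/-- **THE NO-TYPE IS AN INVARIANT.** For odd non-square `d`, two NO-certificates `b·v² = a·u² + 1`, `b'·v'² = a'·u'² + 1` (`a·b = a'·b' = d`, `1 < b`,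
`1 < b'`) have `a = a'` and `b = b'`: for each NOT-reached `d` exactly one ordered factorisation `d = a·b` with `1 < b` makes `b·x² − a·y² = 1` solvable
(Legendre's theorem for the `±1` equations at `d ≡ 3 (mod 4)`; the type is `a = gcd((x₁ − 1)/2, d)`). [bookkeeping] -/
theorem thetaSecant_plusOneCertificate_unique {d a b u v a' b' u' v' : ℕ} (hd : Odd d) (hsq : ¬ IsSquare d)
    (hab : a * b = d) (hb : 1 < b) (hc : b * v ^ 2 = a * u ^ 2 + 1)
    (hab' : a' * b' = d) (hb' : 1 < b') (hc' : b' * v' ^ 2 = a' * u' ^ 2 + 1) : a = a' ∧ b = b' := by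
  have hd0 : (0 : ℤ) < d := by exact_mod_cast hd.pos
  have hd' : Odd (d : ℤ) := (Int.odd_coe_nat d).2 hd
  obtain ⟨a₁, h⟩ := IsFundamental.exists_of_not_isSquare hd0 (by rwa [Int.isSquare_natCast_iff])
  obtain ⟨habz, hbz, hcz⟩ := pell_certificate_int_of_nat hab hb hc
  have hx₁ : Odd a₁.x := pell_odd_fundamental_x_of_certificate hd' h habz hbz hcz
  obtain ⟨a₀, b₀, u₀, v₀, hab₀, ha₀, hb₀, hx₁eq, hc₀⟩ := pell_plusOneSplit_of_odd hd0 hd' hx₁ (by linarith [h.1]) a₁.prop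
  have hcop₀ : IsCoprime a₀ b₀ := ⟨-(u₀ ^ 2), v₀ ^ 2, by linear_combination hc₀⟩
  have hab₀odd : Odd (a₀ * b₀) := by rw [hab₀]; exact hd'
  -- an odd integer is coprime to `2` (inline; the tree's `Literature.Barriers.ABC.isCoprime_two_of_odd` is the same remark)
  have cop2 : ∀ {z : ℤ}, Odd z → IsCoprime z 2 := fun ⟨c, hc⟩ ↦ ⟨1, -c, by rw [hc]; ring⟩
  have ha₀2 : IsCoprime a₀ 2 := cop2 (Int.odd_mul.1 hab₀odd).1
  have hb₀2 : IsCoprime b₀ 2 := cop2 (Int.odd_mul.1 hab₀odd).2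
  -- every NO-certificate of `d` has `a = a₀`
  have key : ∀ {a b u v : ℕ}, a * b = d → 1 < b → b * v ^ 2 = a * u ^ 2 + 1 → (a : ℤ) = a₀ := by
    intro a b u v hab hb hc
    obtain ⟨habz, hbz, hcz⟩ := pell_certificate_int_of_nat hab hb hc
    have hv0 : v ≠ 0 := by rintro rfl; rw [pow_two, mul_zero, mul_zero] at hc; exact Nat.succ_ne_zero _ hc.symm
    have hv1 : (0 : ℤ) < v := by exact_mod_cast Nat.pos_of_ne_zero hv0
    -- the certificate's solution `(2b·v² − 1, 2u·v)`
    obtain ⟨S, hSx⟩ : ∃ S : Solution₁ (d : ℤ), S.x = 2 * b * (v : ℤ) ^ 2 - 1 :=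
      ⟨Solution₁.mk (2 * b * (v : ℤ) ^ 2 - 1) (2 * u * v) (by rw [← habz]; linear_combination (4 * b * (v : ℤ) ^ 2) * hcz),
        Solution₁.x_mk _ _ _⟩
    have hSpos : 0 < S.x := by
      have : (0 : ℤ) < b * (v : ℤ) ^ 2 := mul_pos (by linarith) (by positivity)
      rw [hSx]; linarith
    obtain ⟨n, hn⟩ := h.eq_zpow_or_neg_zpow S
    have hS : S = a₁ ^ n := by
      rcases hn with hn | hn
      · exact hn
      · exfalso
        have h1 : 0 < (a₁ ^ n).x := Solution₁.x_zpow_pos (by linarith [h.1]) n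
        rw [hn, Solution₁.x_neg] at hSpos
        linarith
    obtain ⟨hA, hBodd, hBeven⟩ := pell_noType_dvd_zpow a₁ hab₀ hx₁eq hc₀ n
    rw [← hS, hSx] at hA hBodd hBeven
    have hbcop : IsCoprime (b : ℤ) ((a : ℤ) * (u : ℤ) ^ 2) := ⟨(v : ℤ) ^ 2, -1, by linear_combination hcz⟩
    rcases Int.even_or_odd n with hn2 | hn2
    · -- `n` even: `d ∣ x_n − 1 = 2·a·u²`, so `b ∣ a·u²` and `b` is a unit — contradiction with `1 < b`
      exfalso
      have hdd : (d : ℤ) ∣ 2 * ((a : ℤ) * (u : ℤ) ^ 2) := by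
        rw [show 2 * ((a : ℤ) * (u : ℤ) ^ 2) = 2 * b * (v : ℤ) ^ 2 - 1 - 1 by linear_combination (-2 : ℤ) * hcz, ← hab₀]
        exact hcop₀.mul_dvd hA (hBeven hn2)
      have hbodd : Odd (b : ℤ) := (Int.odd_mul.1 (by rw [habz]; exact hd' : Odd ((a : ℤ) * b))).2
      have hbau : (b : ℤ) ∣ (a : ℤ) * (u : ℤ) ^ 2 :=
        (cop2 hbodd).dvd_of_dvd_mul_left (dvd_trans ⟨(a : ℤ), by rw [← habz, mul_comm]⟩ hdd)
      rcases Int.isUnit_iff.1 (hbcop.isUnit_of_dvd' dvd_rfl hbau) with h1 | h1 <;> linarith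
    · -- `n` odd: `a₀ ∣ a·u²`, `b₀ ∣ a·u² + 1`
      have hA' : a₀ ∣ ((a * u ^ 2 : ℕ) : ℤ) := by
        rw [show 2 * (b : ℤ) * (v : ℤ) ^ 2 - 1 - 1 = 2 * ((a * u ^ 2 : ℕ) : ℤ) by push_cast; linear_combination 2 * hcz] at hA
        exact ha₀2.dvd_of_dvd_mul_left hA
      have hB' : b₀ ∣ ((a * u ^ 2 + 1 : ℕ) : ℤ) := by
        have hB := hBodd hn2
        rw [show 2 * (b : ℤ) * (v : ℤ) ^ 2 - 1 + 1 = 2 * ((a * u ^ 2 + 1 : ℕ) : ℤ) by push_cast; linear_combination 2 * hcz] at hB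
        exact hb₀2.dvd_of_dvd_mul_left hB
      have e1 : (a₀.natAbs : ℤ) = a₀ := by rw [Int.natCast_natAbs, abs_of_pos ha₀]
      have e2 : (b₀.natAbs : ℤ) = b₀ := by rw [Int.natCast_natAbs, abs_of_pos hb₀]
      have h₀ : a₀.natAbs * b₀.natAbs = a * b := by
        have : ((a₀.natAbs * b₀.natAbs : ℕ) : ℤ) = ((a * b : ℕ) : ℤ) := by push_cast; rw [abs_of_pos ha₀, abs_of_pos hb₀, hab₀, ← habz]
        exact_mod_cast this
      have := plusOneType_eq_of_dvd hc h₀ (Int.natCast_dvd_natCast.1 (by rw [e1]; exact hA'))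
        (Int.natCast_dvd_natCast.1 (by rw [e2]; exact hB'))
      rw [this, e1]
  have haa : a = a' := by exact_mod_cast (key hab hb hc).trans (key hab' hb' hc').symm
  refine ⟨haa, ?_⟩
  have ha0 : 0 < a := Nat.pos_of_ne_zero (by rintro rfl; rw [zero_mul] at hab; have := Nat.odd_iff.1 (hab ▸ hd); omega)
  exact Nat.eq_of_mul_eq_mul_left ha0 (by rw [hab, ← hab', haa])

/-- **LEGENDRE'S THEOREM at `d ≡ 3 (mod 4)`, in the cell's currency.** For odd non-square `d`: exactly one of the two certificate kinds exists
(predecessor `thetaSecant_plusOne_xor_plusTwo`), and inside each kind the ordered factorisation `(a, b)` is unique (`…plusOneCertificate_unique` above,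
predecessor `…plusTwoCertificate_unique`) — so among the equations «`b·v² − a·u² = 1`, `a·b = d`, `1 < b`» and «`b·v² − a·u² = 2`, `a·b = d`» EXACTLY ONE
is solvable: the NO-type or the YES-type of `d` in the reach table. [bookkeeping] -/
theorem thetaSecant_legendre_uniqueness {d : ℕ} (hd : Odd d) (hsq : ¬ IsSquare d) :
    Xor (∃ a b u v : ℕ, a * b = d ∧ 1 < b ∧ b * v ^ 2 = a * u ^ 2 + 1) (∃ a b u v : ℕ, a * b = d ∧ b * v ^ 2 = a * u ^ 2 + 2) ∧
    (∀ a b u v a' b' u' v' : ℕ, a * b = d → 1 < b → b * v ^ 2 = a * u ^ 2 + 1 →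
      a' * b' = d → 1 < b' → b' * v' ^ 2 = a' * u' ^ 2 + 1 → a = a' ∧ b = b') ∧
    (∀ a b u v a' b' u' v' : ℕ, a * b = d → b * v ^ 2 = a * u ^ 2 + 2 →
      a' * b' = d → b' * v' ^ 2 = a' * u' ^ 2 + 2 → a = a' ∧ b = b') :=
  ⟨thetaSecant_plusOne_xor_plusTwo hd hsq,
    fun _ _ _ _ _ _ _ _ hab hb hc hab' hb' hc' ↦ thetaSecant_plusOneCertificate_unique hd hsq hab hb hc hab' hb' hc',
    fun _ _ _ _ _ _ _ _ hab hc hab' hc' ↦ thetaSecant_plusTwoCertificate_unique hd hab hc hab' hc'⟩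

/-! ## §3 The fundamental solution modulo a prime `p ≡ 3 (mod 4)` -/

/-- **`x₁ (mod p)`.** For a prime `p ≡ 3 (mod 4)` with fundamental solution `a₁` of `x² − p·y² = 1`: `x₁ ≡ -1 (mod p)` if `p ≡ 3 (mod 8)` and `x₁ ≡ 1 (mod p)`
if `p ≡ 7 (mod 8)` (`x₁` is even — `pell_even_x_of_isFundamental_of_prime` —, its YES-certificate has `x₁ = a·u² + 1 = b·v² − 1`, and the type `(a, b)` is
`(1, p)` resp. `(p, 1)` by `pell_plusTwo_prime_type`). E.g. `p = 7`: `x₁ = 8 ≡ 1`; `p = 11`: `x₁ = 10 ≡ -1`. [bookkeeping] -/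
theorem pell_fundamental_x_modEq_of_prime {p : ℕ} (hp : p.Prime) (hp4 : p % 4 = 3) {a₁ : Solution₁ (p : ℤ)} (h : IsFundamental a₁) :
    (p % 8 = 3 → a₁.x ≡ -1 [ZMOD p]) ∧ (p % 8 = 7 → a₁.x ≡ 1 [ZMOD p]) := by
  have hx₁ : Even a₁.x := pell_even_x_of_isFundamental_of_prime hp hp4 h
  obtain ⟨m₁, k₁, hm₁, hmk₁, hxm₁⟩ := pell_natWitness_of_even_x a₁ hx₁ (by linarith [h.1])
  obtain ⟨a, b, u, v, hab, hcert, hm₁eq⟩ := thetaSecant_plusTwoCertificate_of_reach hm₁ hmk₁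
  have hp2 : p ≠ 2 := by rintro rfl; norm_num at hp4
  rcases pell_plusTwo_prime_type hp hp2 hab hcert with ⟨rfl, rfl, h3⟩ | ⟨rfl, rfl, h7⟩
  · refine ⟨fun _ ↦ Int.modEq_iff_dvd.2 ⟨-((v : ℤ) ^ 2), ?_⟩, fun h7 ↦ by omega⟩
    rw [hxm₁, hm₁eq]
    have hz : ((b * v ^ 2 : ℕ) : ℤ) = ((1 * u ^ 2 + 2 : ℕ) : ℤ) := by exact_mod_cast hcert
    push_cast at hz ⊢
    linear_combination hz
  · refine ⟨fun h3 ↦ by omega, fun _ ↦ Int.modEq_iff_dvd.2 ⟨-((u : ℤ) ^ 2), ?_⟩⟩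
    rw [hxm₁, hm₁eq]
    push_cast
    ring

end PellNoTypes

/-! ## Audit: nothing is decided here
KERNEL: §1 the half-descent of an odd `x` with the link `x = 2·a·u² + 1`; §2 uniqueness of the NO-type and, with the predecessors, Legendre's theorem at
`d ≡ 3 (mod 4)` in the cell's currency; §3 `x₁ ≡ ∓1 (mod p)` for primes `p ≡ 3, 7 (mod 8)`. NOT decided: anything about Weil classes, semiregularity or the
census verdict (candidates 0; deciding rows «NO-in-families-tried»).
-/

end Summit.Ventures.HSemireg

end
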